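import Summits.HodgeConjecture.CorCM.IrreducibleOddWeightsCertificate
import Summits.HodgeConjecture.CorCM.ParallelShadowsCapacity
import HarnessLib

/-!
# Wedderburn certificates V: parity — a full certificate restricts to an odd certificate

COR-CM (cell `pub-hodgecm2`, binder seat `b16` gen 58, count-neutral claim CERTIFICATES, file F6 — abstract finite-group
level; theorems only, no definition, no named fact, no `sorry`).  NEW as stated, hence under `Summits/`.  HONEST FRAMING:
finite-dimensional linear algebra over `ℚ` (the bookkeeping between a FULL Wedderburn certificate of a finite group `G` —
F1, `C = ℚ^G` — and the ODD certificate consumed by the CM-type files F2/F3/F5); `HC_CM` is neither used nor asserted.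

Let `ρ ∈ G` be CENTRAL with `ρ² = 1` (in the CM use: complex conjugation in `Gal(L/ℚ)`), and let `(π_k, V_k, Z_k)_k` be a
FULL certificate: `Z_k`-linear non-zero `ℚ`-representations, `Σ_k r_k d_k ≤ |G|`, `ℚ^G` faithful on `⊕_k V_k`.

* §1 **`apply_rho_eq_or_of_certificate`** — PARITY: `π_k(ρ) = +1` or `π_k(ρ) = −1` on all of `V_k` (`π_k(ρ)` is a
  `G`-endomorphism, hence a `Z_k`-scalar `t` by F1, and `t² = 1` in the division ring `Z_k`).
* §2 `sum_smul_eq_zero_of_odd_of_even` / `…_of_even_of_odd` — odd coefficient functions act by `0` in even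
  representations and even ones by `0` in odd representations (reindex `g ↦ ρg`).
* §3 **`oddFaithful_of_certificate`** — the odd functions `ℚ[G]⁻` are faithful on the ODD members alone;
  **`sum_odd_le_finrank_antiWeights_of_certificate`** — the odd members satisfy the odd COUNT
  `Σ_{π_k(ρ) = −1} r_k d_k ≤ dim ℚ[G]⁻` (symmetric functions inject into `∏_{even}`, odd ones into `∏_{odd}`, and
  `dim Sym + dim Anti = |G|`); `two_mul_sum_odd_le_card_of_certificate` — `2 Σ_{odd} r_k d_k ≤ |G|` as soon as `G` carries a
  CM type for `ρ`.  So the sub-family `{k // π_k(ρ) = −1}` of a full certificate IS an odd certificate, and the formulas of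
  F3/F5 apply to it verbatim.

## References

* [Serre1977] J.-P. Serre, *Linear Representations of Finite Groups*, GTM 42 (1977), §6.5 Prop. 16 and §12.2.
* [Kubota1965] T. Kubota, *On the field extension by complex multiplication*, Trans. AMS 118 (1965), §2 (p. 115).
-/

set_option autoImplicit false

noncomputable section

open scoped BigOperators

universe u' v w

namespace Summit.HodgeConjecture.CorCM.IrrOdd

open Literature.NumberTheory.ComplexMultiplication

variable {G : Type w} [Group G] [Fintype G]
variable {K : Type u'} [Fintype K]
variable {V : K → Type v} [∀ k, AddCommGroup (V k)] [∀ k, Module ℚ (V k)] [∀ k, FiniteDimensional ℚ (V k)]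
variable {Z : K → Type*} [∀ k, DivisionRing (Z k)] [∀ k, Module (Z k) (V k)] [∀ k, Module.Finite (Z k) (V k)]

/-! ### §1 Parity of the members of a full certificate -/

/-- **PARITY: a central involution acts on each member of a full certificate by `+1` or by `−1`.**  (`π_k(ρ)` commutes
with `G`, so it is a `Z_k`-scalar `t` by the commutant theorem of F1; `t² = 1` in the division ring `Z_k`.)
[cite: Serre1977, §6.5 Prop. 16 and §12.2] -/
theorem apply_rho_eq_or_of_certificate (π : ∀ k, Representation ℚ G (V k)) [∀ k, Nontrivial (V k)]
    (hlin : ∀ k (g : G) (z : Z k) (v : V k), π k g (z • v) = z • π k g v)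
    (hcount : ∑ k, Module.finrank (Z k) (V k) * Module.finrank ℚ (V k) ≤ Fintype.card G)
    (hfaith : ∀ c : G → ℚ, (∀ k, ∑ g, c g • π k g = 0) → c = 0) {ρ : G} (hρ : ∀ g : G, g * ρ = ρ * g)
    (hρ2 : ρ * ρ = 1) (k : K) : (∀ v, π k ρ v = v) ∨ (∀ v, π k ρ v = -v) := by
  classical
  have hcount' : ∑ k, Module.finrank (Z k) (V k) * Module.finrank ℚ (V k) ≤
      Module.finrank ℚ (⊤ : Submodule ℚ (G → ℚ)) := by
    rwa [finrank_top, Module.finrank_fintype_fun_eq_card]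
  have hfaith' : ∀ c ∈ (⊤ : Submodule ℚ (G → ℚ)), (∀ k, ∑ g, c g • π k g = 0) → c = 0 := fun c _ hc => hfaith c hc
  -- `π_k(ρ)` as a `G`-endomorphism
  let S : (π k).IntertwiningMap (π k) := LinearMap.intertwiningMap_of_isIntertwiningMap (π k) (π k) (π k ρ)
    fun g v => by rw [← Module.End.mul_apply, ← map_mul, ← hρ g, map_mul, Module.End.mul_apply]
  obtain ⟨t, ht⟩ := exists_smul_eq_of_certificate π hlin ⊤ hcount' hfaith' k S
  have hS : ∀ v, π k ρ v = t • v := ht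
  -- `t² = 1`
  obtain ⟨v₀, hv₀⟩ := exists_ne (0 : V k)
  have htt : t * t = 1 := by
    have h1 : (t * t) • v₀ = v₀ := by
      rw [mul_smul, ← hS, ← hS, ← Module.End.mul_apply, ← map_mul, hρ2, map_one, Module.End.one_apply]
    have h2 : (t * t - 1) • v₀ = 0 := by rw [sub_smul, h1, one_smul, sub_self]
    exact sub_eq_zero.1 ((smul_eq_zero.1 h2).resolve_right hv₀)
  have ht1 : (t - 1) * (t + 1) = 0 := by
    rw [sub_mul, mul_add, mul_add, one_mul, one_mul, mul_one, htt]; abel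
  rcases mul_eq_zero.1 ht1 with h | h
  · left
    intro v
    rw [hS, sub_eq_zero.1 h, one_smul]
  · right
    intro v
    rw [hS, eq_neg_of_add_eq_zero_left h, neg_one_smul]

/-! ### §2 Cross terms vanish -/

omit [Fintype K] [∀ k, FiniteDimensional ℚ (V k)] in
/-- An ODD coefficient function acts by zero in an EVEN representation. [cite: Kubota1965, §2 (p. 115)] -/
theorem sum_smul_eq_zero_of_odd_of_even {W : Type*} [AddCommGroup W] [Module ℚ W] (τ : Representation ℚ G W) {ρ : G}
    {c : G → ℚ} (hc : ∀ g, c (ρ * g) = -c g) (heven : ∀ w, τ ρ w = w) : ∑ g, c g • τ g = 0 := by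
  ext w
  have h : (∑ g, c g • τ g) w = -((∑ g, c g • τ g) w) := by
    conv_lhs => rw [LinearMap.sum_apply, ← Equiv.sum_comp (Equiv.mulLeft ρ)]
    rw [LinearMap.sum_apply, ← Finset.sum_neg_distrib]
    refine Finset.sum_congr rfl fun g _ => ?_
    rw [Equiv.coe_mulLeft, LinearMap.smul_apply, LinearMap.smul_apply, hc, map_mul, Module.End.mul_apply, heven,
      neg_smul]
  rw [LinearMap.zero_apply]
  have h2 : (2 : ℚ) • (∑ g, c g • τ g) w = 0 := by rw [two_smul]; nth_rw 2 [h]; exact add_neg_cancel _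
  exact (smul_eq_zero.1 h2).resolve_left two_ne_zero

omit [Fintype K] [∀ k, FiniteDimensional ℚ (V k)] in
/-- An EVEN coefficient function acts by zero in an ODD representation. [cite: Kubota1965, §2 (p. 115)] -/
theorem sum_smul_eq_zero_of_even_of_odd {W : Type*} [AddCommGroup W] [Module ℚ W] (τ : Representation ℚ G W) {ρ : G}
    {c : G → ℚ} (hc : ∀ g, c (ρ * g) = c g) (hodd : ∀ w, τ ρ w = -w) : ∑ g, c g • τ g = 0 := by
  ext w
  have h : (∑ g, c g • τ g) w = -((∑ g, c g • τ g) w) := by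
    conv_lhs => rw [LinearMap.sum_apply, ← Equiv.sum_comp (Equiv.mulLeft ρ)]
    rw [LinearMap.sum_apply, ← Finset.sum_neg_distrib]
    refine Finset.sum_congr rfl fun g _ => ?_
    rw [Equiv.coe_mulLeft, LinearMap.smul_apply, LinearMap.smul_apply, hc, map_mul, Module.End.mul_apply, hodd,
      smul_neg]
  rw [LinearMap.zero_apply]
  have h2 : (2 : ℚ) • (∑ g, c g • τ g) w = 0 := by rw [two_smul]; nth_rw 2 [h]; exact add_neg_cancel _
  exact (smul_eq_zero.1 h2).resolve_left two_ne_zero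

/-! ### §3 The odd members of a full certificate form an odd certificate -/

/-- **ODD FAITHFULNESS from full faithfulness**: an odd `c` killed by every ODD member of a full certificate is zero
(it is killed by the even members automatically, §2, and every member is even or odd, §1).
[cite: Serre1977, §6.5 Prop. 16 and §12.2] -/
theorem oddFaithful_of_certificate (π : ∀ k, Representation ℚ G (V k)) [∀ k, Nontrivial (V k)]
    (hlin : ∀ k (g : G) (z : Z k) (v : V k), π k g (z • v) = z • π k g v)
    (hcount : ∑ k, Module.finrank (Z k) (V k) * Module.finrank ℚ (V k) ≤ Fintype.card G)
    (hfaith : ∀ c : G → ℚ, (∀ k, ∑ g, c g • π k g = 0) → c = 0) {ρ : G} (hρ : ∀ g : G, g * ρ = ρ * g)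
    (hρ2 : ρ * ρ = 1) (c : G → ℚ) (hc : ∀ g, c (ρ * g) = -c g)
    (h0 : ∀ k : {k : K // ∀ v, π k ρ v = -v}, ∑ g, c g • π k.1 g = 0) : c = 0 := by
  refine hfaith c fun k => ?_
  rcases apply_rho_eq_or_of_certificate π hlin hcount hfaith hρ hρ2 k with hk | hk
  · exact sum_smul_eq_zero_of_odd_of_even (π k) hc hk
  · exact h0 ⟨k, hk⟩

open scoped Classical in
/-- **THE ODD COUNT from the full count: `Σ_{π_k(ρ) = −1} r_k d_k ≤ dim ℚ[G]⁻`.**  The symmetric functions inject into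
`∏_{even} (V_k)^{r_k}` and the odd ones into `∏_{odd} (V_k)^{r_k}` (evaluation of `Σ_g c(g)π_k(g)` on a `Z_k`-basis; cross
terms vanish, §2), while `dim Sym + dim Anti = |G| ≥ Σ_k r_k d_k`. [cite: Serre1977, §6.5 Prop. 16 and §12.2] -/
theorem sum_odd_le_finrank_antiWeights_of_certificate (π : ∀ k, Representation ℚ G (V k)) [∀ k, Nontrivial (V k)]
    (hlin : ∀ k (g : G) (z : Z k) (v : V k), π k g (z • v) = z • π k g v)
    (hcount : ∑ k, Module.finrank (Z k) (V k) * Module.finrank ℚ (V k) ≤ Fintype.card G)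
    (hfaith : ∀ c : G → ℚ, (∀ k, ∑ g, c g • π k g = 0) → c = 0) {ρ : G} (hρ : ∀ g : G, g * ρ = ρ * g)
    (hρ2 : ρ * ρ = 1) :
    ∑ k : {k : K // ∀ v, π k ρ v = -v}, Module.finrank (Z k.1) (V k.1) * Module.finrank ℚ (V k.1) ≤
      Module.finrank ℚ (antiWeights (E := G) ρ) := by
  classical
  have hpar := apply_rho_eq_or_of_certificate π hlin hcount hfaith hρ hρ2
  -- even = not odd
  have heven_iff : ∀ k, (¬ ∀ v, π k ρ v = -v) ↔ ∀ v, π k ρ v = v := by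
    intro k
    constructor
    · intro h
      exact (hpar k).resolve_right h
    · intro h hodd
      obtain ⟨v₀, hv₀⟩ := exists_ne (0 : V k)
      have : (2 : ℚ) • v₀ = 0 := by rw [two_smul]; nth_rw 2 [← h v₀]; rw [hodd, add_neg_cancel]
      exact hv₀ ((smul_eq_zero.1 this).resolve_left two_ne_zero)
  -- bases and the evaluation maps
  let b : ∀ k, Module.Basis (Fin (Module.finrank (Z k) (V k))) (Z k) (V k) := fun k => Module.finBasis (Z k) (V k)
  let Θ : ∀ p : K → Prop, (G → ℚ) →ₗ[ℚ] (∀ k : {k // p k}, Fin (Module.finrank (Z k.1) (V k.1)) → V k.1) := fun p =>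
    { toFun := fun c k i => (∑ g, c g • π k.1 g) (b k.1 i)
      map_add' := fun c c' => by
        funext k i
        simp only [Pi.add_apply, add_smul, Finset.sum_add_distrib, LinearMap.add_apply]
      map_smul' := fun q c => by
        funext k i
        simp only [Pi.smul_apply, smul_eq_mul, RingHom.id_apply, mul_smul, ← Finset.smul_sum, LinearMap.smul_apply] }
  have hΘ : ∀ (p : K → Prop) (c : G → ℚ), Θ p c = 0 → ∀ k, p k → ∑ g, c g • π k g = 0 := by
    intro p c hc k hk
    refine eq_of_forall_basis (b k) (sum_smul_apply_smul (π k) (hlin k) _)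
      (fun z v => by rw [LinearMap.zero_apply, LinearMap.zero_apply, smul_zero]) fun i => ?_
    have := congrFun (congrFun hc ⟨k, hk⟩) i
    simpa [Θ] using this
  have hdimT : ∀ p : K → Prop, Module.finrank ℚ (∀ k : {k // p k}, Fin (Module.finrank (Z k.1) (V k.1)) → V k.1) =
      ∑ k : {k // p k}, Module.finrank (Z k.1) (V k.1) * Module.finrank ℚ (V k.1) := by
    intro p
    rw [Module.finrank_pi_fintype ℚ]
    refine Finset.sum_congr rfl fun k _ => ?_
    rw [Module.finrank_pi_fintype ℚ, Finset.sum_const, Finset.card_univ, Fintype.card_fin, smul_eq_mul]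
  -- the odd/even splitting map `A c = c − c ∘ (ρ·)`
  let A : (G → ℚ) →ₗ[ℚ] (G → ℚ) := LinearMap.id - LinearMap.funLeft ℚ ℚ fun g => ρ * g
  have hA : ∀ (c : G → ℚ) (g : G), A c g = c g - c (ρ * g) := fun c g => rfl
  -- `ker A` = symmetric functions inject into the even product
  have hker : Module.finrank ℚ (LinearMap.ker A) ≤
      ∑ k : {k // ∀ v, π k ρ v = v}, Module.finrank (Z k.1) (V k.1) * Module.finrank ℚ (V k.1) := by
    rw [← hdimT]
    refine LinearMap.finrank_le_finrank_of_injective (f := Θ _ ∘ₗ (LinearMap.ker A).subtype) ?_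
    rw [← LinearMap.ker_eq_bot, LinearMap.ker_eq_bot']
    intro c hc
    have hsym : ∀ g, (c : G → ℚ) (ρ * g) = (c : G → ℚ) g := fun g => by
      have := congrFun (LinearMap.mem_ker.1 c.2) g
      rw [hA, Pi.zero_apply, sub_eq_zero] at this
      exact this.symm
    refine Subtype.ext (hfaith _ fun k => ?_)
    rcases hpar k with hk | hk
    · exact hΘ _ _ hc k hk
    · exact sum_smul_eq_zero_of_even_of_odd (π k) hsym hk
  -- `Anti` injects into the odd product
  have hanti : Module.finrank ℚ (antiWeights (E := G) ρ) ≤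
      ∑ k : {k // ∀ v, π k ρ v = -v}, Module.finrank (Z k.1) (V k.1) * Module.finrank ℚ (V k.1) := by
    rw [← hdimT]
    refine LinearMap.finrank_le_finrank_of_injective (f := Θ _ ∘ₗ (antiWeights (E := G) ρ).subtype) ?_
    rw [← LinearMap.ker_eq_bot, LinearMap.ker_eq_bot']
    intro c hc
    have hodd : ∀ g, (c : G → ℚ) (ρ * g) = -(c : G → ℚ) g := mem_antiWeights_iff'.1 c.2
    refine Subtype.ext (hfaith _ fun k => ?_)
    rcases hpar k with hk | hk
    · exact sum_smul_eq_zero_of_odd_of_even (π k) hodd hk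
    · exact hΘ _ _ hc k hk
  -- `range A = Anti`, so `dim ker A + dim Anti = |G|`
  have hrange : LinearMap.range A = antiWeights (E := G) ρ := by
    apply le_antisymm
    · rintro _ ⟨c, rfl⟩
      rw [mem_antiWeights_iff']
      intro g
      rw [smul_eq_mul, hA, hA, ← mul_assoc, hρ2, one_mul, neg_sub]
    · intro c hc
      have hodd : ∀ g, c (ρ * g) = -c g := mem_antiWeights_iff'.1 hc
      refine ⟨(1 / 2 : ℚ) • c, funext fun g => ?_⟩
      rw [hA, Pi.smul_apply, Pi.smul_apply, hodd, smul_eq_mul, smul_eq_mul]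
      ring
  have hsum := LinearMap.finrank_range_add_finrank_ker A
  rw [hrange, Module.finrank_fintype_fun_eq_card] at hsum
  -- the count splits along even/odd
  have hsplit := Fintype.sum_subtype_add_sum_subtype (fun k : K => ∀ v, π k ρ v = -v)
    (fun k => Module.finrank (Z k) (V k) * Module.finrank ℚ (V k))
  have heven_sum : ∑ k : {k // ¬ ∀ v, π k ρ v = -v}, Module.finrank (Z k.1) (V k.1) * Module.finrank ℚ (V k.1) =
      ∑ k : {k // ∀ v, π k ρ v = v}, Module.finrank (Z k.1) (V k.1) * Module.finrank ℚ (V k.1) :=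
    Fintype.sum_equiv (Equiv.subtypeEquivRight fun k => heven_iff k) _ _ fun k => rfl
  rw [heven_sum] at hsplit
  omega

open scoped Classical in
/-- **`2 Σ_{π_k(ρ) = −1} r_k d_k ≤ |G|`** for the odd members of a full certificate, as soon as `G` carries a CM type `Ψ`
for `ρ` (then `dim ℚ[G]⁻ ≤ |G|/2`, `CorCM/ParallelShadowsCapacity.finrank_antiWeights_le`) — the COUNT in the form
consumed by the CM files (`cmFamilyRank_eq_one_add_sum_of_oddCertificate` & Co.).
[cite: Serre1977, §6.5 Prop. 16 and §12.2] [cite: Kubota1965, §2 (p. 115)] -/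
theorem two_mul_sum_odd_le_card_of_certificate (π : ∀ k, Representation ℚ G (V k)) [∀ k, Nontrivial (V k)]
    (hlin : ∀ k (g : G) (z : Z k) (v : V k), π k g (z • v) = z • π k g v)
    (hcount : ∑ k, Module.finrank (Z k) (V k) * Module.finrank ℚ (V k) ≤ Fintype.card G)
    (hfaith : ∀ c : G → ℚ, (∀ k, ∑ g, c g • π k g = 0) → c = 0) {ρ : G} {Ψ : Set G} (hΨ : IsCMTypeWith ρ Ψ) :
    2 * ∑ k : {k : K // ∀ v, π k ρ v = -v}, Module.finrank (Z k.1) (V k.1) * Module.finrank ℚ (V k.1) ≤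
      Fintype.card G := by
  have hρ : ∀ g : G, g * ρ = ρ * g := fun g => by
    have := hΨ.comm g (1 : G)
    simp only [smul_eq_mul, mul_one] at this
    exact this
  have hρ2 : ρ * ρ = 1 := by
    have := hΨ.invol (1 : G)
    simp only [smul_eq_mul, mul_one] at this
    exact this
  have h1 := sum_odd_le_finrank_antiWeights_of_certificate π hlin hcount hfaith hρ hρ2
  have h2 := Shadow.finrank_antiWeights_le hΨ
  omega

end Summit.HodgeConjecture.CorCM.IrrOdd

end
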